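import Summits.AtomisticToContinuum.HydrodynamicLimit.Theses.JeansLoadedDice

/-!
# Birth skeleton of the crux `OneKickFootprint` (stmt-AtomisticToContinuum-9217)

Route `route-AtomisticToContinuum-JeansLoadedDice`, sub-problem `HydrodynamicLimit`, crux decl
`Summit.AtomisticToContinuum.HydrodynamicLimit.Theses.JeansLoadedDice.OneKickFootprint` (rank 3; the
load-bearing TRUE-GAS input of the route's Lindeberg swap `LoadedTransfer` / `Assembly` and of every
kick-by-kick comparison on the board): under the conjunct's frame, kicking the INITIAL datum by rotating the
relative velocity of particles `0,1` by the angle `α` towards their separation vector whenever they are within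
`2ε_N` changes the EXPECTED `χ`-tested empirical density / momentum / energy fields at every Euler time
`t ∈ [0,T′]` by at most `C|α|(N+1)^(-7/3)` — delivery probability `≍ (N+1)⁻¹` × one pair's share `(N+1)⁻¹` ×
the dipole arm `ε_N ≍ (N+1)^(-1/3)` (instead of `(N+1)⁻²` for the ideal gas).
Skeleton registrar `planner-skel-stmt-AtomisticToContinuum-9217-0`, 2026-08-17 (BC3 birth certificate; route
re-audit bin REPAIRABLE). Nothing below restates the crux or the Statement.

## The cut (three named stubs + kernel-checked composition)

The crux's own mechanism reads "a dipole of conserved quantities with arm `≤ 2ε_N` propagated by linearised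
hydrodynamics acting on the test function". Two facts fix WHICH intermediate object makes that sentence a
decomposition:

* Hydrodynamic (acoustic) transport of a LIPSCHITZ test function loses one derivative in three dimensions
  (`Ψ_χ(0) ∼ M_{ct}χ + t·M_{ct}(ω·∇χ)`, spherical means of `∇χ ∈ L^∞`: bounded, NOT Lipschitz), so at `t > 0`
  the `ε_N`-gain can not be read off the two endpoints of the dipole; it comes from averaging the kick LOCATION
  against the translation-smooth near-contact pair law of the local Gibbs state. Hence the time-zero object is
  the MEAN initial conserved footprint measured in TOTAL VARIATION — against bounded measurable `ψ`, no
  regularity — `FootprintTV` below, and the claim that it is `O(|α|(N+1)^(-7/3))` is a STATICS statement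
  (smeared conserved dipole; stub S).
* A footprint-to-response principle can only hold for kicks decided by the PAIR's own data: a rule allowed to
  read the bath microstate could align its sign with the (chaotically large) pathwise derivative of the
  time-`t` observable and produce a mean response at the fluctuation scale `(N+1)^(-3/2) ≫ (N+1)^(-7/3)` with a
  vanishing mean footprint. Hence the heart quantifies over TWO-BODY conservative local velocity kicks
  (`IsPairKick`), a class containing the crux's rotation kick (stub G) and also position-dependent rules, for
  which the total-variation hypothesis is load-bearing (a rule rough in the base point has footprint AND
  response `≫ λ(N+1)^(-7/3)` against a Lipschitz `χ` whose `M_{ct}∇χ` is not of bounded variation).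

* `stub_footprintStatics` (S, statics of the local Gibbs law near contact; size L): under the crux's frame up
  to the matching at `t = 0`, there are `B, N₀` with: for `N ≥ N₀`, `|α| ≤ 1` and EVERY measurable `ψ` with
  `|ψ| ≤ 1`, the kicked-minus-unkicked expectations of the `ψ`-tested density / momentum / energy fields AT TIME
  ZERO are `≤ B|α|(N+1)^(-7/3)`. Density: identically `0` (positions untouched). Momentum / energy: the mean
  footprint measure is `(N+1)⁻¹ ∫ K(x₀,x₁)(δ_{x₁} − δ_{x₀})`, `K` = (mean half-kick given the pair) × (pair
  density), supported on `|x₁ − x₀| < 2ε_N`; its density `(N+1)⁻¹∫_{|h|<2ε}[K(x−h,x) − K(x,x+h)] dh` is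
  `O(ε_N³ · ε_N‖∂_base K‖ /(N+1)) = O((N+1)^(-7/3))` as soon as `K` is `C¹` IN THE BASE POINT at fixed relative
  displacement — i.e. smooth profiles and a cluster-expansion control of the contact pair correlation at small
  `σ`; the matching hypothesis `TendstoHydroFieldsAt … 0` against a CLASSICAL solution is what pins
  `(a₀,u₀,θ₀)` to smooth data (local Gibbs LLN). At global equilibrium the footprint vanishes identically
  (`K(x−h,x)` odd in `h`). NOT implied by the crux (the crux at `t = 0` only tests Lipschitz `χ`).
* `stub_rotKickIsPairKick` (G, Euclidean geometry + measurability; size M, provable now): the crux's rotation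
  kick `rotKick σ N α` is a two-body conservative local velocity kick of relative size `|α|`: it is
  `update (update z 0 (x₀, k₁)) 1 (x₁, k₂)` for a measurable two-body rule `k`, conserves `v₀ + v₁` and
  `‖v₀‖² + ‖v₁‖²` (`e ⊥ g`, `‖g′‖ = ‖g‖`, parallelogram law; the junk branches `g = 0` / `e = 0` are the
  identity), is the identity when `‖x₁ − x₀‖ ≥ 2ε_N`, and moves each velocity by `½‖g′ − g‖ =
  |sin(α/2)|‖g‖ ≤ |α|‖g‖`.
* `stub_footprintTransport` (H, THE HEART — Euler-scale mean linear response of the true hard-sphere gas;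
  open-problem): under the crux's frame, for `T′ < T`, Lipschitz `χ` and every budget `B` there are `C, N₀`
  such that for `N ≥ N₀`, `λ ∈ [0,1]` and EVERY two-body conservative local kick `κ` of size `λ` whose mean
  initial footprint has total variation `≤ Bλ(N+1)^(-7/3)`, the time-`t` responses (`t ∈ [0,T′]`) of the
  `χ`-tested fields are `≤ Cλ(N+1)^(-7/3)`: the mean perturbation of the conserved fields is transported by
  the linearised hard-sphere Euler system along the classical solution (total variation at time `0` →
  Lipschitz-dual at time `t`, one derivative to spare, pre-shock), the non-hydrodynamic content of the kick
  relaxes within `O(1)` mean free times `≍ ε_N` moving conserved content by `O(ε_N)` only, and ring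
  re-collisions of the kicked pair carry weight `O(ρσ³)` without a `1/N` monopole — exactly the crux's
  why-it-might-fail line, now isolated from the statics and the geometry. NOT implied by the crux (it
  quantifies over a class of kicks) and does not imply it (it needs S and G).
* Composition `OneKickFootprint_of : S → G → H → OneKickFootprint` (sorry-free): `σ₀ := min σ_S σ_H`; the
  statics budget `B` of S is fed to H; `N₀ := max N_S N_H`; H is applied with `λ := |α|`, `κ := rotKick σ N α`
  (admissible by G, footprint by S); the crux's `let kick` is `rotKick σ` by `rfl`.
  `OneKickFootprint_skeleton` = the crux modulo the three sorries.

Remark for provers (BC5-type special case): at GLOBAL equilibrium on `𝕋³` (constant profiles) the mean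
response vanishes IDENTICALLY for all `t, N, α` — the local Gibbs law is translation-invariant, the kick and
the flow are translation-covariant, the kick conserves total momentum and energy, so both expectations are the
same uniform averages; the support item `EquilibriumKickResponse` (stmt-9219) is a symmetry statement.

Disproof used: none exists for this crux (`ledger crux ls stmt-AtomisticToContinuum-9217`: no workfiles at
registration). Negatives index: no refuted statement of the summit is an instance of S, G or H (no contact
budget of `ContactIntensityDomination` type, no speed cap, no clamp appears in them).
-/

noncomputable section

namespace Summit.AtomisticToContinuum.HydrodynamicLimit.Cruxes.OneKickFootprint.Birth

open scoped BigOperators Topology Manifold Classical MeasureTheory ProbabilityTheory Matrix InnerProductSpace ComplexConjugate ContinuousMap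
open Filter Set Function TopologicalSpace MeasureTheory
open Literature.Analysis.FluidPDE Literature.MathematicalPhysics.KineticTheory
open Summit.AtomisticToContinuum.HydrodynamicLimit.Theses

/-! ## §0 Objects of the line -/

/-- **The crux's rotation kick**, verbatim the `let kick` of `JeansLoadedDice.OneKickFootprint` with the
reduced density `σ` as a parameter: rotate the relative velocity `g = v₁ − v₀` of particles `0, 1` by the
angle `α` towards their separation vector `w = x₁ − x₀` (minimal image), keeping the centre-of-mass velocity
`c` and `‖g‖`, whenever `‖w‖ < 2ε_N` and the rotation plane is defined (`e ≠ 0`). -/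
def rotKick (σ : ℝ) : (N : ℕ) → ℝ → Config (N + 1) (Fin 3) T3 → Config (N + 1) (Fin 3) T3 :=
  fun N α z => let w : V3 := (Torus.geometry (Fin 3)).sepVec (z 1).1 (z 0).1; let g : V3 := (z 1).2 - (z 0).2; let c : V3 := (2 : ℝ)⁻¹ • ((z 0).2 + (z 1).2); let e : V3 := w - (⟪w, g⟫_ℝ / ‖g‖ ^ 2) • g; let g' : V3 := Real.cos α • g + (Real.sin α * ‖g‖ * ‖e‖⁻¹) • e; if ‖w‖ < 2 * hsDiameter σ N ∧ e ≠ 0 then Function.update (Function.update z 0 ((z 0).1, c - (2 : ℝ)⁻¹ • g')) 1 ((z 1).1, c + (2 : ℝ)⁻¹ • g') else z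

/-- **Two-body conservative local velocity kick of relative size `lam`** (the class the heart quantifies
over): `κ z` replaces the velocities of particles `0` and `1` by a MEASURABLE function `k` of the pair's own
data `(z 0, z 1)` only (no access to the bath), leaves positions and all other particles untouched, conserves
the pair's momentum `v₀ + v₁` and kinetic energy `‖v₀‖² + ‖v₁‖²`, is the identity unless the minimal-image
separation is `< 2ε_N`, and moves each velocity by at most `lam · ‖v₁ − v₀‖`. -/
def IsPairKick (σ : ℝ) (N : ℕ) (lam : ℝ)
    (κ : Config (N + 1) (Fin 3) T3 → Config (N + 1) (Fin 3) T3) : Prop :=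
  ∃ k : (T3 × V3) × (T3 × V3) → V3 × V3, Measurable k ∧
    (∀ z : Config (N + 1) (Fin 3) T3,
      κ z = Function.update (Function.update z 0 ((z 0).1, (k (z 0, z 1)).1)) 1 ((z 1).1, (k (z 0, z 1)).2)) ∧
    ∀ p q : T3 × V3,
      (k (p, q)).1 + (k (p, q)).2 = p.2 + q.2 ∧
      ‖(k (p, q)).1‖ ^ 2 + ‖(k (p, q)).2‖ ^ 2 = ‖p.2‖ ^ 2 + ‖q.2‖ ^ 2 ∧
      (2 * hsDiameter σ N ≤ ‖(Torus.geometry (Fin 3)).sepVec q.1 p.1‖ → k (p, q) = (p.2, q.2)) ∧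
      ‖(k (p, q)).1 - p.2‖ ≤ lam * ‖q.2 - p.2‖ ∧ ‖(k (p, q)).2 - q.2‖ ≤ lam * ‖q.2 - p.2‖

/-- **Mean initial conserved footprint in total variation, with budget `b`.** For EVERY measurable test
function `ψ` with `|ψ| ≤ 1` (no regularity), the kicked-minus-unkicked expectations under the local Gibbs law
of the `ψ`-tested empirical density, momentum and energy fields of the INITIAL configuration are `≤ b`: the
three mean perturbation measures `E_P[U_N ∘ κ] − E_P[U_N]` on `𝕋³` have total variation `≲ b`. -/
def FootprintTV (σ : ℝ) (a₀ : T3 → ℝ) (u₀ : T3 → V3) (θ₀ : T3 → ℝ) (N : ℕ)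
    (Φ : HardSphereFlow (Torus.geometry (Fin 3)) (hsDiameter σ N) (N + 1))
    (κ : Config (N + 1) (Fin 3) T3 → Config (N + 1) (Fin 3) T3) (b : ℝ) : Prop :=
  ∀ ψ : T3 → ℝ, Measurable ψ → (∀ x, |ψ x| ≤ 1) →
    |(∫ z, empiricalDensityField (κ z) ψ ∂(localGibbsLaw σ a₀ u₀ θ₀ N Φ)) -
        ∫ z, empiricalDensityField z ψ ∂(localGibbsLaw σ a₀ u₀ θ₀ N Φ)| ≤ b ∧
    ‖(∫ z, empiricalMomentumField (κ z) ψ ∂(localGibbsLaw σ a₀ u₀ θ₀ N Φ)) -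
        ∫ z, empiricalMomentumField z ψ ∂(localGibbsLaw σ a₀ u₀ θ₀ N Φ)‖ ≤ b ∧
    |(∫ z, empiricalEnergyField (κ z) ψ ∂(localGibbsLaw σ a₀ u₀ θ₀ N Φ)) -
        ∫ z, empiricalEnergyField z ψ ∂(localGibbsLaw σ a₀ u₀ θ₀ N Φ)| ≤ b

/-! ## §1 Stub signatures

Each stub's statement is the `Prop` `Sig.stub_<name>`; the registered obligation is
`theorem stub_<name> : Sig.stub_<name> := by sorry` (§2); the composition `OneKickFootprint_of` takes the three
signatures as hypotheses BY NAME. -/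

/-- **S — the mean initial footprint of the rotation kick is a smeared conserved dipole of total variation
`O(|α|(N+1)^(-7/3))` (statics; size L).** Under the crux's frame (continuous positive profiles, `σ < σ₀`, a
classical hard-sphere Euler solution on `[0,T)`, hard-sphere flows, local Gibbs data whose fields converge at
`t = 0`) there are `B, N₀` such that for `N ≥ N₀` and `|α| ≤ 1` the kick `rotKick σ N α` has `FootprintTV`
budget `B|α|(N+1)^(-7/3)`. Why plausibly true: delivery probability `≍ σ³∫ρ₀²·g₂(contact)/(N+1)`, velocity
change `≤ |α|‖g‖` with Maxwellian moments, one pair's share `(N+1)⁻¹`, and the smearing gain `ε_N` from the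
`C¹` dependence of the near-contact pair law on its base point (activity expansion at small `σ`; profiles
pinned to the smooth classical data by the matching hypothesis and the local Gibbs LLN). Why it might fail:
base-point smoothness of the CONTACT pair correlation of the inhomogeneous hard-sphere local Gibbs state,
uniformly in `N`, is a cluster-expansion statement at small packing that is not in the tree. Leans on:
`localGibbsLaw`, `canonicalDensity`, `localGibbsProfile`, the landed fine-scale statics toolbox
`LocalGibbsFineScale` (route BoxDissipativeWeakStrong). Sources: Spohn1991 Part I Ch. 3, Ruelle1969 §4. -/
def Sig.stub_footprintStatics : Prop :=
  ∀ (a₀ θ₀ : T3 → ℝ) (u₀ : T3 → V3), Continuous a₀ → Continuous θ₀ → Continuous u₀ →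
    (∀ x, 0 < a₀ x) → (∀ x, 0 < θ₀ x) →
    ∃ σ₀ : ℝ, 0 < σ₀ ∧ ∀ σ : ℝ, 0 < σ → σ < σ₀ →
      ∀ (T : ℝ) (ρ θ : ℝ → T3 → ℝ) (u : ℝ → T3 → V3), IsHardSphereEulerSolution σ T ρ u θ →
        ∀ Φ : (N : ℕ) → HardSphereFlow (Torus.geometry (Fin 3)) (hsDiameter σ N) (N + 1),
          TendstoHydroFieldsAt (fun N => localGibbsLaw σ a₀ u₀ θ₀ N (Φ N)) Φ ρ u θ 0 →
            ∃ B : ℝ, ∃ N₀ : ℕ, ∀ N : ℕ, N₀ ≤ N → ∀ α : ℝ, |α| ≤ 1 →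
              FootprintTV σ a₀ u₀ θ₀ N (Φ N) (rotKick σ N α)
                (B * |α| * ((N + 1 : ℕ) : ℝ) ^ (-(7 / 3 : ℝ)))

/-- **G — the rotation kick is a two-body conservative local velocity kick of size `|α|` (geometry +
measurability; size M, provable now).** For every `σ, N, α`: `rotKick σ N α` is given by a measurable two-body
rule, conserves the pair's momentum (`(c − ½g′) + (c + ½g′) = v₀ + v₁`) and kinetic energy (`e ⊥ g` hence
`‖g′‖ = ‖g‖`, then the parallelogram law; the junk branches `g = 0`, `e = 0` are the identity), is the identity
when the minimal-image separation is `≥ 2ε_N`, and moves each velocity by `½‖g′ − g‖ = |sin(α/2)|·‖g‖ ≤ |α|‖g‖`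
(`1 − cos α ≤ α²/2`). Leans on: `Function.update`, `real_inner_self_eq_norm_sq`,
`Real.one_sub_sq_div_two_le_cos`, measurability of `Torus.geometry` (`Torus.measurable_geometry_sepVec`). -/
def Sig.stub_rotKickIsPairKick : Prop :=
  ∀ (σ : ℝ) (N : ℕ) (α : ℝ), IsPairKick σ N (|α|) (rotKick σ N α)

/-- **H — THE HEART: Euler-scale transport of the mean footprint (open-problem).** Under the crux's frame,
for every `T′ < T`, Lipschitz `χ` and budget `B` there are `C, N₀` such that for `N ≥ N₀`, `lam ∈ [0,1]` and
EVERY two-body conservative local kick `κ` of size `lam` (`IsPairKick σ N lam κ`) whose mean initial footprint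
has total variation `≤ B·lam·(N+1)^(-7/3)` (`FootprintTV`), the kicked-minus-unkicked expectations of the
`χ`-tested density, momentum and energy fields at every `t ∈ [0,T′]` are `≤ C·lam·(N+1)^(-7/3)`. Content: the
mean perturbation of the conserved fields is transported by the LINEARISED hard-sphere Euler system along the
classical solution (total variation at time `0` → Lipschitz-dual at time `t`: one derivative to spare,
pre-shock), the non-hydrodynamic part of the kick relaxes in the mean within `O(1)` mean free times `≍ ε_N`
(moving conserved content by `O(ε_N)`), and the kicked pair's ring re-collisions have weight `O(ρσ³)` with no
`(N+1)⁻¹` monopole. Why it might fail: verbatim the crux's — a slow non-hydrodynamic mode or kick-biased later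
collisions of the pair give `C·lam/(N+1)²`; false for the ideal gas (which has no relaxation). Sources:
Spohn1991 Part II §7 (linear response / Green–Kubo at equilibrium), OllaVaradhanYau1993,
BodineauGallagherSaintRaymondSimonella2023 (doi:10.4007/annals.2023.198.3.3), LiveraniOlla1996. -/
def Sig.stub_footprintTransport : Prop :=
  ∀ (a₀ θ₀ : T3 → ℝ) (u₀ : T3 → V3), Continuous a₀ → Continuous θ₀ → Continuous u₀ →
    (∀ x, 0 < a₀ x) → (∀ x, 0 < θ₀ x) →
    ∃ σ₀ : ℝ, 0 < σ₀ ∧ ∀ σ : ℝ, 0 < σ → σ < σ₀ →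
      ∀ (T : ℝ) (ρ θ : ℝ → T3 → ℝ) (u : ℝ → T3 → V3), IsHardSphereEulerSolution σ T ρ u θ →
        ∀ Φ : (N : ℕ) → HardSphereFlow (Torus.geometry (Fin 3)) (hsDiameter σ N) (N + 1),
          TendstoHydroFieldsAt (fun N => localGibbsLaw σ a₀ u₀ θ₀ N (Φ N)) Φ ρ u θ 0 →
            ∀ T' : ℝ, T' < T → ∀ (χ : T3 → ℝ) (K : NNReal), LipschitzWith K χ →
              ∀ B : ℝ, ∃ C : ℝ, ∃ N₀ : ℕ, ∀ N : ℕ, N₀ ≤ N → ∀ lam : ℝ, 0 ≤ lam → lam ≤ 1 →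
                ∀ κ : Config (N + 1) (Fin 3) T3 → Config (N + 1) (Fin 3) T3, IsPairKick σ N lam κ →
                  FootprintTV σ a₀ u₀ θ₀ N (Φ N) κ (B * lam * ((N + 1 : ℕ) : ℝ) ^ (-(7 / 3 : ℝ))) →
                    ∀ t ∈ Icc 0 T',
                      |(∫ z, empiricalDensityField ((Φ N).flow t (κ z)) χ ∂(localGibbsLaw σ a₀ u₀ θ₀ N (Φ N))) -
                          ∫ z, empiricalDensityField ((Φ N).flow t z) χ ∂(localGibbsLaw σ a₀ u₀ θ₀ N (Φ N))| ≤
                        C * lam * ((N + 1 : ℕ) : ℝ) ^ (-(7 / 3 : ℝ)) ∧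
                      ‖(∫ z, empiricalMomentumField ((Φ N).flow t (κ z)) χ ∂(localGibbsLaw σ a₀ u₀ θ₀ N (Φ N))) -
                          ∫ z, empiricalMomentumField ((Φ N).flow t z) χ ∂(localGibbsLaw σ a₀ u₀ θ₀ N (Φ N))‖ ≤
                        C * lam * ((N + 1 : ℕ) : ℝ) ^ (-(7 / 3 : ℝ)) ∧
                      |(∫ z, empiricalEnergyField ((Φ N).flow t (κ z)) χ ∂(localGibbsLaw σ a₀ u₀ θ₀ N (Φ N))) -
                          ∫ z, empiricalEnergyField ((Φ N).flow t z) χ ∂(localGibbsLaw σ a₀ u₀ θ₀ N (Φ N))| ≤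
                        C * lam * ((N + 1 : ℕ) : ℝ) ^ (-(7 / 3 : ℝ))

/-! ## §2 Stubs (registered; `sorry` only inside them) — hardest: `stub_footprintTransport` -/

/-- **S (L).** Total-variation footprint of the rotation kick at time zero. -/
theorem stub_footprintStatics : Sig.stub_footprintStatics := by
  sorry

/-- **G (M, provable now).** The rotation kick is a two-body conservative local kick of size `|α|`. -/
theorem stub_rotKickIsPairKick : Sig.stub_rotKickIsPairKick := by
  sorry

/-- **H (open-problem; the heart).** Euler-scale transport of the mean footprint for two-body kicks. -/
theorem stub_footprintTransport : Sig.stub_footprintTransport := by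
  sorry

/-! ## §3 Composition (sorry-free) -/

/-- **The line closes the crux modulo its stubs**: `OneKickFootprint` BY NAME from S, G, H. Real content:
the common density threshold `min σ_S σ_H`, the statics budget `B` of S handed to H, the common `N₀ := max`,
and the instantiation of the heart at `lam := |α|`, `κ := rotKick σ N α` (admissible by G, footprint by S);
the crux's `let kick` is `rotKick σ` definitionally. -/
theorem OneKickFootprint_of (hS : Sig.stub_footprintStatics) (hG : Sig.stub_rotKickIsPairKick)
    (hH : Sig.stub_footprintTransport) : JeansLoadedDice.OneKickFootprint := by
  intro a₀ θ₀ u₀ ha hθ hu hap hθp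
  obtain ⟨σ₁, hσ₁, HS⟩ := hS a₀ θ₀ u₀ ha hθ hu hap hθp
  obtain ⟨σ₂, hσ₂, HH⟩ := hH a₀ θ₀ u₀ ha hθ hu hap hθp
  refine ⟨min σ₁ σ₂, lt_min hσ₁ hσ₂, ?_⟩
  intro σ hσ hσlt T ρ θ u hsol Φ h0 T' hT' χ K hχ
  have hσ₁' : σ < σ₁ := lt_of_lt_of_le hσlt (min_le_left _ _)
  have hσ₂' : σ < σ₂ := lt_of_lt_of_le hσlt (min_le_right _ _)
  obtain ⟨B, N₁, HB⟩ := HS σ hσ hσ₁' T ρ θ u hsol Φ h0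
  obtain ⟨C, N₂, HC⟩ := HH σ hσ hσ₂' T ρ θ u hsol Φ h0 T' hT' χ K hχ B
  show ∃ C : ℝ, ∃ N₀ : ℕ, ∀ N : ℕ, N₀ ≤ N → ∀ α : ℝ, |α| ≤ 1 → ∀ t ∈ Icc 0 T',
    |(∫ z, empiricalDensityField ((Φ N).flow t (rotKick σ N α z)) χ ∂(localGibbsLaw σ a₀ u₀ θ₀ N (Φ N))) -
        ∫ z, empiricalDensityField ((Φ N).flow t z) χ ∂(localGibbsLaw σ a₀ u₀ θ₀ N (Φ N))| ≤
      C * |α| * ((N + 1 : ℕ) : ℝ) ^ (-(7 / 3 : ℝ)) ∧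
    ‖(∫ z, empiricalMomentumField ((Φ N).flow t (rotKick σ N α z)) χ ∂(localGibbsLaw σ a₀ u₀ θ₀ N (Φ N))) -
        ∫ z, empiricalMomentumField ((Φ N).flow t z) χ ∂(localGibbsLaw σ a₀ u₀ θ₀ N (Φ N))‖ ≤
      C * |α| * ((N + 1 : ℕ) : ℝ) ^ (-(7 / 3 : ℝ)) ∧
    |(∫ z, empiricalEnergyField ((Φ N).flow t (rotKick σ N α z)) χ ∂(localGibbsLaw σ a₀ u₀ θ₀ N (Φ N))) -
        ∫ z, empiricalEnergyField ((Φ N).flow t z) χ ∂(localGibbsLaw σ a₀ u₀ θ₀ N (Φ N))| ≤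
      C * |α| * ((N + 1 : ℕ) : ℝ) ^ (-(7 / 3 : ℝ))
  refine ⟨C, max N₁ N₂, ?_⟩
  intro N hN α hα t ht
  have hN₁ : N₁ ≤ N := le_trans (le_max_left _ _) hN
  have hN₂ : N₂ ≤ N := le_trans (le_max_right _ _) hN
  exact HC N hN₂ |α| (abs_nonneg α) hα (rotKick σ N α) (hG σ N α) (HB N hN₁ α hα) t ht

/-- The skeleton instantiated: the crux modulo the three registered stubs. -/
theorem OneKickFootprint_skeleton : JeansLoadedDice.OneKickFootprint :=
  OneKickFootprint_of stub_footprintStatics stub_rotKickIsPairKick stub_footprintTransport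

end Summit.AtomisticToContinuum.HydrodynamicLimit.Cruxes.OneKickFootprint.Birth

end
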